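import Mathlib
import Summits.ValiantsHypothesis.ValiantsHypothesis.Theorems.LiouvilleSarnakAlignedTypeICharactersMod2nDefs
import Literature.NumberTheory.LFunctions.LiouvilleTwoPowerModuli
import HarnessLib

/-!
# Route LiouvilleSarnak — support `AlignedTypeI` (stmt-ValiantsHypothesis-21040), line `characters_mod_2n`:
# stub `stub_twistedLiouvilleSmall`: reduction to Möbius sums twisted by characters to `2`-power moduli,
# and the Green range unconditionally

The registered stub `stub_twistedLiouvilleSmall : TwistedLiouvilleSmall` of the line
`Cruxes/AlignedTypeI/Lines/characters_mod_2n.lean` asks: for every `ε > 0` and all large `n`, every level `k ≤ n`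
and every Dirichlet character `χ` mod `2^k` satisfy `‖Σ_{m ≤ 2^(n+k)} λ(m) χ(m)‖ ≤ ε 2^(n+k)` (moduli `2^k ≤ √x`,
`x = 2^(n+k)`).  Its cite-grade input is a statement about the MÖBIUS function: Banks–Shparlinski, *Sums with the
Möbius function twisted by characters with powerful moduli*, Trans. AMS (2019), Thm 2.2 (primitive characters of
conductor `2^γ`, `γ ≥ γ₀`), together with Green 2012 Thm 3 (= the tree's PROVED
`Literature.NumberTheory.LFunctions.green_moebius_character_twoPower_holds`) for the finitely many small conductors.

This file proves, unconditionally, the TRANSFER from Möbius to Liouville in the `o(x)` currency with moduli up to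
the length (`twistedLiouvilleSmall_of_moebius`):

> if for every `ε > 0` there is `y₀` such that `‖Σ_{n ≤ y} μ(n) χ(n)‖ ≤ ε y` for all real `y ≥ y₀`, all `t` with
> `2^t ≤ y` and all Dirichlet characters `χ` mod `2^t`, then `TwistedLiouvilleSmall` holds.

The hypothesis is spelled out (no definition); it is exactly what Banks–Shparlinski Thm 2.2 (all three ranges of
their `E₁`, conductor `≥ 2^{γ₀}`) plus Green's theorem (conductor `< 2^{γ₀}`) deliver for `2`-power moduli — that
derivation is NOT done here.  The transfer is `λ = 𝟙_□ ⋆ μ` with the completely multiplicative twist: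
`Σ_{n ≤ N} λχ = Σ_{d² ≤ N} χ(d²) Σ_{m ≤ N/d²} μχ` (§2 = the tree's `LiouvilleTwoPower.sum_liouville_character_eq`),
the squares `d ≤ D` carrying the
hypothesis at `y = N/d² ≥ N/D² ≥ 2^k` and the squares `d > D` the trivial bound `N Σ_{d > D} d^{-2} ≤ N/D` (§3).

§5 proves, with NO hypothesis, the part of the stub that the tree already carries: the levels `k` with
`2^k ≤ exp(c √log x)` (Green 2012, Thm 3 = Montgomery–Vaughan §11.3.1 Exercise 6 for `q = 2^t`; no exceptional zero
for `2`-power conductors), from the tree's PROVED `LiouvilleTwoPower.norm_sum_liouville_character_le`: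
`twisted_norm_le_of_two_pow_le_exp` (all `(n, k, χ)` with `2^k ≤ exp(c √(log 2^(n+k)))`),
`twisted_norm_le_of_le_sqrt` (all levels `k ≤ c'√n`), `twisted_norm_le_of_level_le` (all levels `k ≤ K`, `K` fixed —
the form the assembly `alignedTypeI_of_KMT_BS` consumes below its threshold level).

HONEST FRAMING. `TwistedLiouvilleSmall` is NOT proved here (its Möbius input for conductors `2^γ`, `c√log x < γ log 2`,
is Banks–Shparlinski 2019 Thm 2.2, not in the tree); the stub is not closed by name; `AlignedTypeI` is not closed;
nothing here bears on `VP ≠ VNP` (NOT proved).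
-/

set_option linter.dupNamespace false

noncomputable section

namespace Summit.ValiantsHypothesis.ValiantsHypothesis.Theorems.LiouvilleSarnak.AlignedTypeI.CharactersModTwoN

open ArithmeticFunction Finset
open scoped BigOperators ArithmeticFunction.Moebius

/-! ## §1 Range bookkeeping: the stub's `Fin (2^(n+k))`-indexed sum is `Σ_{1 ≤ m ≤ 2^(n+k)}` -/

/-- `Σ_{m : Fin N} f(m+1) = Σ_{m ∈ (0, N]} f(m)`. [folklore] -/
theorem sum_fin_succ_eq_sum_Ioc {M : Type*} [AddCommMonoid M] (f : ℕ → M) (N : ℕ) :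
    ∑ m : Fin N, f ((m : ℕ) + 1) = ∑ m ∈ Ioc 0 N, f m := by
  rw [Fin.sum_univ_eq_sum_range (fun i => f (i + 1)) N]
  induction N with
  | zero => simp
  | succ N ih => rw [Finset.sum_range_succ, ih, Finset.sum_Ioc_succ_top (Nat.zero_le N)]

/-- The stub's twisted sum at `(n, k, χ)` written over `Ioc 0 (2^(n+k))`. [folklore] -/
theorem twistedSum_eq_Ioc (n k : ℕ) (χ : DirichletCharacter ℂ (2 ^ k)) :
    ∑ m : Fin (2 ^ (n + k)), ((liouville ((m : ℕ) + 1) : ℤ) : ℂ) * χ (((m : ℕ) + 1 : ℕ) : ZMod (2 ^ k))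
      = ∑ m ∈ Ioc 0 (2 ^ (n + k)), ((liouville m : ℤ) : ℂ) * χ ((m : ℕ) : ZMod (2 ^ k)) :=
  sum_fin_succ_eq_sum_Ioc (fun m => ((liouville m : ℤ) : ℂ) * χ ((m : ℕ) : ZMod (2 ^ k))) _

/-- The same with the real floor `⌊2^(n+k)⌋₊`, the currency of the tree's character-sum estimates. [folklore] -/
theorem twistedSum_eq_Ioc_floor (n k : ℕ) (χ : DirichletCharacter ℂ (2 ^ k)) :
    ∑ m : Fin (2 ^ (n + k)), ((liouville ((m : ℕ) + 1) : ℤ) : ℂ) * χ (((m : ℕ) + 1 : ℕ) : ZMod (2 ^ k))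
      = ∑ m ∈ Ioc 0 ⌊((2 : ℝ) ^ (n + k))⌋₊, ((liouville m : ℤ) : ℂ) * χ ((m : ℕ) : ZMod (2 ^ k)) := by
  have hfloor : ⌊((2 : ℝ) ^ (n + k))⌋₊ = 2 ^ (n + k) := by
    rw [show ((2 : ℝ) ^ (n + k)) = ((2 ^ (n + k) : ℕ) : ℝ) by push_cast; rfl, Nat.floor_natCast]
  rw [hfloor]
  exact twistedSum_eq_Ioc n k χ

/-! ## §2 `Λ(N, χ) = Σ_{a ≤ N, a = □} χ(a) M(N/a, χ)`

This is the tree's `Literature.NumberTheory.LFunctions.LiouvilleTwoPower.sum_liouville_character_eq` (Dirichlet's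
rearrangement of `λ = 𝟙_□ ⋆ μ` with the completely multiplicative twist), used below together with the trivial
bound `LiouvilleTwoPower.norm_sum_moebius_mul_character_le`. -/

/-! ## §3 The transfer estimate -/

/-- **Möbius to Liouville with a character twist.**  If the twisted Möbius sums satisfy
`‖M(N/d², χ)‖ ≤ δ N/d²` for `1 ≤ d ≤ D`, then `‖Σ_{n ≤ N} λ(n)χ(n)‖ ≤ 2 δ N + N/D`: by §2 and `|χ| ≤ 1` the left
side is at most `Σ_{d ≤ √N} ‖M(N/d², χ)‖`; the squares `d ≤ D` give `δ N Σ d^{-2} ≤ 2 δ N`, the others the trivial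
`Σ_{d > D} N/d² ≤ N/D`. [folklore] -/
theorem norm_twisted_liouville_le_of_moebius {q : ℕ} (χ : DirichletCharacter ℂ q) (N D : ℕ) (hD : 1 ≤ D)
    {δ : ℝ} (hδ : 0 ≤ δ)
    (hM : ∀ d ∈ Ioc 0 D,
      ‖∑ m ∈ Ioc 0 (N / (d * d)), ((μ m : ℤ) : ℂ) * χ (m : ZMod q)‖ ≤ δ * ((N : ℝ) / ((d * d : ℕ) : ℝ))) :
    ‖∑ n ∈ Ioc 0 N, ((liouville n : ℤ) : ℂ) * χ (n : ZMod q)‖ ≤ 2 * δ * N + N / D := by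
  set M : ℕ → ℂ := fun a => ∑ m ∈ Ioc 0 (N / a), ((μ m : ℤ) : ℂ) * χ (m : ZMod q) with hMdef
  have hMtriv : ∀ a : ℕ, ‖M a‖ ≤ (N : ℝ) / a := by
    intro a
    rcases Nat.eq_zero_or_pos a with rfl | ha
    · simp [hMdef]
    · exact (Literature.NumberTheory.LFunctions.LiouvilleTwoPower.norm_sum_moebius_mul_character_le χ
        (N / a)).trans (Nat.cast_div_le)
  -- step 1: `‖Λ‖ ≤ Σ_{a ≤ N, a = □} ‖M a‖ = Σ_{r ≤ √N} ‖M (r r)‖`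
  have h1 : ‖∑ n ∈ Ioc 0 N, ((liouville n : ℤ) : ℂ) * χ (n : ZMod q)‖ ≤
      ∑ r ∈ Ioc 0 (Nat.sqrt N), ‖M (r * r)‖ := by
    rw [Literature.NumberTheory.LFunctions.LiouvilleTwoPower.sum_liouville_character_eq]
    calc ‖∑ a ∈ Ioc 0 N, (if IsSquare a then χ (a : ZMod q) else 0) * M a‖
        ≤ ∑ a ∈ Ioc 0 N, ‖(if IsSquare a then χ (a : ZMod q) else 0) * M a‖ := norm_sum_le _ _
      _ ≤ ∑ a ∈ Ioc 0 N, (if IsSquare a then ‖M a‖ else 0) := by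
          refine sum_le_sum fun a _ => ?_
          rw [norm_mul]
          split_ifs with h
          · exact (mul_le_mul_of_nonneg_right (χ.norm_le_one _) (norm_nonneg _)).trans (by rw [one_mul])
          · simp
      _ = ∑ a ∈ (Ioc 0 N).filter IsSquare, ‖M a‖ := by rw [sum_filter]
      _ = ∑ r ∈ Ioc 0 (Nat.sqrt N), ‖M (r * r)‖ := by
          rw [Literature.NumberTheory.LFunctions.SiegelWalfiszLiouville.filter_isSquare_Ioc_eq_image,
            sum_image]
          intro r₁ _ r₂ _ h
          exact Nat.mul_self_inj.mp h
  -- step 2: termwise `‖M (r r)‖ ≤ δ N / r² + [D < r] N / r²`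
  have h2 : ∀ r ∈ Ioc 0 (Nat.sqrt N), ‖M (r * r)‖ ≤
      δ * ((N : ℝ) / ((r : ℝ) ^ 2)) + (if D < r then (N : ℝ) / ((r : ℝ) ^ 2) else 0) := by
    intro r hr
    rw [mem_Ioc] at hr
    have hr0 : (0 : ℝ) < r := by exact_mod_cast hr.1
    have hcast : ((r * r : ℕ) : ℝ) = (r : ℝ) ^ 2 := by push_cast; ring
    by_cases hrD : D < r
    · rw [if_pos hrD]
      have := hMtriv (r * r)
      rw [hcast] at this
      have h0 : 0 ≤ δ * ((N : ℝ) / ((r : ℝ) ^ 2)) := by positivity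
      linarith
    · rw [if_neg hrD, add_zero]
      have := hM r (mem_Ioc.mpr ⟨hr.1, not_lt.mp hrD⟩)
      rwa [hcast] at this
  -- step 3: sum the two pieces
  have h3 : ∑ r ∈ Ioc 0 (Nat.sqrt N), δ * ((N : ℝ) / ((r : ℝ) ^ 2)) ≤ 2 * δ * N := by
    rw [← mul_sum]
    have hs : ∑ r ∈ Ioc 0 (Nat.sqrt N), (N : ℝ) / ((r : ℝ) ^ 2) ≤ 2 * N := by
      have := Literature.NumberTheory.LFunctions.SiegelWalfiszLiouville.sum_Ioc_inv_sq_le_two (Nat.sqrt N)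
      calc ∑ r ∈ Ioc 0 (Nat.sqrt N), (N : ℝ) / ((r : ℝ) ^ 2)
          = (N : ℝ) * ∑ r ∈ Ioc 0 (Nat.sqrt N), 1 / ((r : ℝ) ^ 2) := by
            rw [mul_sum]; exact sum_congr rfl fun r _ => by ring
        _ ≤ (N : ℝ) * 2 := mul_le_mul_of_nonneg_left this (Nat.cast_nonneg N)
        _ = 2 * N := by ring
    calc δ * ∑ r ∈ Ioc 0 (Nat.sqrt N), (N : ℝ) / ((r : ℝ) ^ 2) ≤ δ * (2 * N) :=
          mul_le_mul_of_nonneg_left hs hδ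
      _ = 2 * δ * N := by ring
  have h4 : ∑ r ∈ Ioc 0 (Nat.sqrt N), (if D < r then (N : ℝ) / ((r : ℝ) ^ 2) else 0) ≤ N / D := by
    rw [← sum_filter]
    have hsub : (Ioc 0 (Nat.sqrt N)).filter (fun r => D < r) = Ioc D (Nat.sqrt N) := by
      ext r
      simp only [mem_filter, mem_Ioc]
      omega
    rw [hsub]
    have := Literature.NumberTheory.LFunctions.SiegelWalfiszLiouville.sum_Ioc_inv_sq_le hD (Nat.sqrt N)
    calc ∑ r ∈ Ioc D (Nat.sqrt N), (N : ℝ) / ((r : ℝ) ^ 2)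
        = (N : ℝ) * ∑ r ∈ Ioc D (Nat.sqrt N), 1 / ((r : ℝ) ^ 2) := by
          rw [mul_sum]; exact sum_congr rfl fun r _ => by ring
      _ ≤ (N : ℝ) * (1 / D) := mul_le_mul_of_nonneg_left this (Nat.cast_nonneg N)
      _ = N / D := by ring
  calc ‖∑ n ∈ Ioc 0 N, ((liouville n : ℤ) : ℂ) * χ (n : ZMod q)‖
      ≤ ∑ r ∈ Ioc 0 (Nat.sqrt N), ‖M (r * r)‖ := h1
    _ ≤ ∑ r ∈ Ioc 0 (Nat.sqrt N),
          (δ * ((N : ℝ) / ((r : ℝ) ^ 2)) + (if D < r then (N : ℝ) / ((r : ℝ) ^ 2) else 0)) := sum_le_sum h2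
    _ = ∑ r ∈ Ioc 0 (Nat.sqrt N), δ * ((N : ℝ) / ((r : ℝ) ^ 2)) +
          ∑ r ∈ Ioc 0 (Nat.sqrt N), (if D < r then (N : ℝ) / ((r : ℝ) ^ 2) else 0) := sum_add_distrib
    _ ≤ 2 * δ * N + N / D := add_le_add h3 h4

/-! ## §4 `TwistedLiouvilleSmall` from the Möbius statement -/

/-- **The registered stub `stub_twistedLiouvilleSmall` reduced to Möbius sums.**  If for every `ε > 0` there is
`y₀` with `‖Σ_{n ≤ y} μ(n) χ(n)‖ ≤ ε y` for all real `y ≥ y₀`, all `t` with `2^t ≤ y` and all Dirichlet characters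
`χ` mod `2^t` (Möbius–character sums are `o(y)` uniformly for `2`-power moduli up to `y` — Banks–Shparlinski 2019
Thm 2.2 for conductors `2^γ ≥ 2^{γ₀}` plus Green 2012 Thm 3 below; NOT proved in the tree), then
`TwistedLiouvilleSmall`.  Proof: §3 at `N = 2^(n+k)`, `δ = ε/4`, `D = ⌈4/ε⌉`, the hypothesis being used at
`y = N/d² ≥ N/D² ≥ max(y₀, 2^k)` for `d ≤ D` (note `2^k ≤ 2^n` as `k ≤ n`), valid once `2^n ≥ (y₀ ⊔ 1) D²`.
[folklore] -/
theorem twistedLiouvilleSmall_of_moebius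
    (hμ : ∀ ε : ℝ, 0 < ε → ∃ y₀ : ℝ, ∀ y : ℝ, y₀ ≤ y → ∀ (t : ℕ) (χ : DirichletCharacter ℂ (2 ^ t)),
      (2 : ℝ) ^ t ≤ y →
        ‖∑ n ∈ Ioc 0 ⌊y⌋₊, ((ArithmeticFunction.moebius n : ℤ) : ℂ) * χ (n : ZMod (2 ^ t))‖ ≤ ε * y) :
    TwistedLiouvilleSmall := by
  intro ε hε
  -- constants
  set δ : ℝ := ε / 4 with hδdef
  have hδ : 0 < δ := by positivity
  obtain ⟨y₀, hy₀⟩ := hμ δ hδ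
  obtain ⟨D, hD⟩ := exists_nat_ge (4 / ε)
  have hD1 : 1 ≤ D := by
    have h : (0 : ℝ) < D := lt_of_lt_of_le (by positivity) hD
    exact_mod_cast Nat.one_le_iff_ne_zero.mpr (by rintro rfl; simp at h)
  have hD0 : (0 : ℝ) < D := by exact_mod_cast hD1
  -- threshold: `2^n ≥ (max y₀ 1) D²`
  obtain ⟨T, hT⟩ := exists_nat_ge (max y₀ 1 * (D : ℝ) ^ 2)
  refine ⟨T, fun n hn k hkn χ => ?_⟩
  have h2n : max y₀ 1 * (D : ℝ) ^ 2 ≤ (2 : ℝ) ^ n :=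
    hT.trans ((show (T : ℝ) ≤ n by exact_mod_cast hn).trans (by exact_mod_cast Nat.lt_two_pow_self.le))
  set N : ℕ := 2 ^ (n + k) with hN
  have hNreal : (N : ℝ) = (2 : ℝ) ^ (n + k) := by rw [hN]; push_cast; rfl
  have hNk : (2 : ℝ) ^ k * 2 ^ n = N := by rw [hNreal, pow_add, mul_comm]
  rw [twistedSum_eq_Ioc]
  -- the Möbius hypothesis at `y = N/d²`, `d ≤ D`
  have hM : ∀ d ∈ Ioc 0 D,
      ‖∑ m ∈ Ioc 0 (N / (d * d)), ((μ m : ℤ) : ℂ) * χ (m : ZMod (2 ^ k))‖ ≤ δ * ((N : ℝ) / ((d * d : ℕ) : ℝ)) := by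
    intro d hd
    rw [mem_Ioc] at hd
    have hd0 : (0 : ℝ) < d := by exact_mod_cast hd.1
    have hdD : (d : ℝ) ≤ D := by exact_mod_cast hd.2
    set y : ℝ := (N : ℝ) / ((d * d : ℕ) : ℝ) with hy
    have hfloor : ⌊y⌋₊ = N / (d * d) := by rw [hy, Nat.floor_div_eq_div]
    have hdd : ((d * d : ℕ) : ℝ) = (d : ℝ) ^ 2 := by push_cast; ring
    -- `y ≥ N / D² ≥ max y₀ 1 · 2^k ≥ y₀` and `≥ 2^k`
    have hylow : max y₀ 1 * (2 : ℝ) ^ k ≤ y := by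
      rw [hy, hdd, le_div_iff₀ (by positivity)]
      calc max y₀ 1 * (2 : ℝ) ^ k * (d : ℝ) ^ 2 ≤ max y₀ 1 * (2 : ℝ) ^ k * (D : ℝ) ^ 2 := by gcongr
        _ = (2 : ℝ) ^ k * (max y₀ 1 * (D : ℝ) ^ 2) := by ring
        _ ≤ (2 : ℝ) ^ k * 2 ^ n := mul_le_mul_of_nonneg_left h2n (by positivity)
        _ = N := hNk
    have h1k : (1 : ℝ) ≤ (2 : ℝ) ^ k := one_le_pow₀ (by norm_num)
    have hyy₀ : y₀ ≤ y := by
      calc y₀ ≤ max y₀ 1 := le_max_left _ _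
        _ = max y₀ 1 * 1 := (mul_one _).symm
        _ ≤ max y₀ 1 * (2 : ℝ) ^ k := mul_le_mul_of_nonneg_left h1k (le_trans zero_le_one (le_max_right _ _))
        _ ≤ y := hylow
    have hyk : (2 : ℝ) ^ k ≤ y := by
      calc (2 : ℝ) ^ k = 1 * (2 : ℝ) ^ k := (one_mul _).symm
        _ ≤ max y₀ 1 * (2 : ℝ) ^ k := mul_le_mul_of_nonneg_right (le_max_right _ _) (by positivity)
        _ ≤ y := hylow
    have := hy₀ y hyy₀ k χ hyk
    rwa [hfloor] at this
  refine (norm_twisted_liouville_le_of_moebius χ N D hD1 hδ.le hM).trans ?_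
  -- `2 δ N + N/D ≤ ε N`
  have hND : (N : ℝ) / D ≤ ε / 4 * N := by
    rw [div_le_iff₀ hD0]
    have : (4 : ℝ) / ε * (ε / 4 * N) = N := by field_simp
    calc (N : ℝ) = 4 / ε * (ε / 4 * N) := this.symm
      _ ≤ D * (ε / 4 * N) := mul_le_mul_of_nonneg_right hD (by positivity)
      _ = ε / 4 * N * D := by ring
  calc 2 * δ * (N : ℝ) + N / D ≤ 2 * (ε / 4) * N + ε / 4 * N := by rw [hδdef]; gcongr
    _ ≤ ε * N := by nlinarith [Nat.cast_nonneg (α := ℝ) N, hε.le]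
    _ = ε * 2 ^ (n + k) := by rw [hNreal]

/-- `log 2^(n+k) = (n+k) log 2 ≥ n log 2`. [folklore] -/
theorem mul_log_two_le_log_two_pow (n k : ℕ) :
    (n : ℝ) * Real.log 2 ≤ Real.log ((2 : ℝ) ^ (n + k)) := by
  rw [Real.log_pow]
  push_cast
  nlinarith [Real.log_pos one_lt_two, (Nat.cast_nonneg k : (0 : ℝ) ≤ k)]

/-! ## §5 The Green range, unconditionally -/

/-- **Twisted Liouville sums to `2`-power moduli in the Green range, in the stub's currency.** There is an
absolute `c > 0` such that for every `ε > 0` and all `n ≥ n₀(ε)`: for every level `k` with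
`2^k ≤ exp(c √(log 2^(n+k)))` and every Dirichlet character `χ` mod `2^k`,
`‖Σ_{m ≤ 2^(n+k)} λ(m) χ(m)‖ ≤ ε 2^(n+k)`.  From the tree's proved
`LiouvilleTwoPower.norm_sum_liouville_character_le` (`≤ C x e^{-c√log x}`) and `e^{-c√log x} → 0`.
[cite: Green2012, Theorem 3 and §1 (remark on the Liouville function)] -/
theorem twisted_norm_le_of_two_pow_le_exp :
    ∃ c : ℝ, 0 < c ∧ ∀ ε : ℝ, 0 < ε → ∃ n₀ : ℕ, ∀ n ≥ n₀, ∀ k : ℕ,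
      (2 : ℝ) ^ k ≤ Real.exp (c * Real.sqrt (Real.log ((2 : ℝ) ^ (n + k)))) →
      ∀ χ : DirichletCharacter ℂ (2 ^ k),
        ‖∑ m : Fin (2 ^ (n + k)), ((liouville ((m : ℕ) + 1) : ℤ) : ℂ) *
            χ (((m : ℕ) + 1 : ℕ) : ZMod (2 ^ k))‖ ≤ ε * 2 ^ (n + k) := by
  obtain ⟨c, hc, C, hC0, h⟩ :=
    Literature.NumberTheory.LFunctions.LiouvilleTwoPower.norm_sum_liouville_character_le
  refine ⟨c, hc, fun ε hε => ?_⟩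
  -- it suffices that `√(log x) ≥ L := log ((C + 1) / ε) / c`, i.e. `n log 2 ≥ (max L 0)²`
  set L : ℝ := Real.log ((C + 1) / ε) / c with hL
  have hlog2 : 0 < Real.log 2 := Real.log_pos one_lt_two
  obtain ⟨N, hN⟩ := exists_nat_ge (max L 0 ^ 2 / Real.log 2)
  refine ⟨max N 1, fun n hn k hk χ => ?_⟩
  have hn1 : 1 ≤ n := le_trans (le_max_right _ _) hn
  have hnN : (N : ℝ) ≤ n := by exact_mod_cast le_trans (le_max_left _ _) hn
  have hlogx_ge : (n : ℝ) * Real.log 2 ≤ Real.log ((2 : ℝ) ^ (n + k)) := mul_log_two_le_log_two_pow n k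
  set x : ℝ := (2 : ℝ) ^ (n + k) with hx
  have hx2 : (2 : ℝ) ≤ x := by
    calc (2 : ℝ) = 2 ^ 1 := by norm_num
      _ ≤ 2 ^ (n + k) := pow_le_pow_right₀ (by norm_num) (by omega)
  have hx0 : 0 < x := by positivity
  rw [twistedSum_eq_Ioc_floor]
  refine (h k χ x hx2 hk).trans ?_
  -- `√(log x) ≥ L`
  have hs : L ≤ Real.sqrt (Real.log x) := by
    have h1 : (max L 0) ^ 2 ≤ Real.log x := by
      have h2 : (max L 0) ^ 2 / Real.log 2 ≤ n := le_trans hN hnN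
      rw [div_le_iff₀ hlog2] at h2
      exact h2.trans hlogx_ge
    have h3 : max L 0 ≤ Real.sqrt (Real.log x) := by
      rw [← Real.sqrt_sq (le_max_right L 0)]
      exact Real.sqrt_le_sqrt h1
    exact (le_max_left _ _).trans h3
  -- hence `e^{-c √log x} ≤ ε / (C + 1)`
  have hexp : Real.exp (-c * Real.sqrt (Real.log x)) ≤ ε / (C + 1) := by
    have h4 : Real.log ((C + 1) / ε) ≤ c * Real.sqrt (Real.log x) := by
      have h5 : c * L ≤ c * Real.sqrt (Real.log x) := mul_le_mul_of_nonneg_left hs hc.le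
      have h6 : c * L = Real.log ((C + 1) / ε) := by rw [hL]; field_simp
      linarith
    calc Real.exp (-c * Real.sqrt (Real.log x))
        ≤ Real.exp (-Real.log ((C + 1) / ε)) := Real.exp_le_exp.mpr (by linarith)
      _ = ε / (C + 1) := by rw [Real.exp_neg, Real.exp_log (by positivity), inv_div]
  calc C * x * Real.exp (-c * Real.sqrt (Real.log x))
      ≤ C * x * (ε / (C + 1)) := by gcongr
    _ = C / (C + 1) * (ε * x) := by ring
    _ ≤ 1 * (ε * x) := by
        gcongr
        exact (div_le_one (by positivity)).mpr (by linarith)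
    _ = ε * x := one_mul _

/-- **All levels `k ≤ c' √n`.** There is an absolute `c' > 0` such that for every `ε > 0` and all
`n ≥ n₀(ε)`, every level `k ≤ c' √n` and every `χ` mod `2^k` satisfy the stub's inequality
`‖Σ_{m ≤ 2^(n+k)} λ(m) χ(m)‖ ≤ ε 2^(n+k)` (`2^k = e^{k log 2} ≤ e^{c √(n log 2)} ≤ e^{c √log 2^(n+k)}` for
`c' = c / √log 2`). [folklore] -/
theorem twisted_norm_le_of_le_sqrt :
    ∃ c' : ℝ, 0 < c' ∧ ∀ ε : ℝ, 0 < ε → ∃ n₀ : ℕ, ∀ n ≥ n₀, ∀ k : ℕ, (k : ℝ) ≤ c' * Real.sqrt n →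
      ∀ χ : DirichletCharacter ℂ (2 ^ k),
        ‖∑ m : Fin (2 ^ (n + k)), ((liouville ((m : ℕ) + 1) : ℤ) : ℂ) *
            χ (((m : ℕ) + 1 : ℕ) : ZMod (2 ^ k))‖ ≤ ε * 2 ^ (n + k) := by
  obtain ⟨c, hc, hmain⟩ := twisted_norm_le_of_two_pow_le_exp
  have hlog2 : 0 < Real.log 2 := Real.log_pos one_lt_two
  have hsl : 0 < Real.sqrt (Real.log 2) := Real.sqrt_pos.mpr hlog2
  refine ⟨c / Real.sqrt (Real.log 2), by positivity, fun ε hε => ?_⟩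
  obtain ⟨n₀, hn₀⟩ := hmain ε hε
  refine ⟨n₀, fun n hn k hk χ => hn₀ n hn k ?_ χ⟩
  -- `2^k = e^{k log 2}` and `k log 2 ≤ c √(n log 2) ≤ c √(log 2^(n+k))`
  have h2k : (2 : ℝ) ^ k = Real.exp (k * Real.log 2) := by
    rw [← Real.rpow_natCast, Real.rpow_def_of_pos (by norm_num : (0 : ℝ) < 2), mul_comm]
  rw [h2k, Real.exp_le_exp]
  have h1 : (k : ℝ) * Real.log 2 ≤ c * (Real.sqrt n * Real.sqrt (Real.log 2)) := by
    have h2 : (k : ℝ) * Real.log 2 ≤ c / Real.sqrt (Real.log 2) * Real.sqrt n * Real.log 2 :=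
      mul_le_mul_of_nonneg_right hk hlog2.le
    have h3 : c / Real.sqrt (Real.log 2) * Real.sqrt n * Real.log 2
        = c * (Real.sqrt n * Real.sqrt (Real.log 2)) := by
      calc c / Real.sqrt (Real.log 2) * Real.sqrt n * Real.log 2
          = c * Real.sqrt n * (Real.log 2 / Real.sqrt (Real.log 2)) := by ring
        _ = c * Real.sqrt n * Real.sqrt (Real.log 2) := by rw [Real.div_sqrt]
        _ = c * (Real.sqrt n * Real.sqrt (Real.log 2)) := by ring
    linarith
  refine h1.trans (mul_le_mul_of_nonneg_left ?_ hc.le)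
  rw [← Real.sqrt_mul (Nat.cast_nonneg n)]
  exact Real.sqrt_le_sqrt (mul_log_two_le_log_two_pow n k)

/-- **All levels below a fixed `K`.** For every `K` and `ε > 0` there is `n₀` with: for all `n ≥ n₀`, all
`k ≤ K` and all `χ` mod `2^k`, `‖Σ_{m ≤ 2^(n+k)} λ(m) χ(m)‖ ≤ ε 2^(n+k)` — the bounded-level part of
`TwistedLiouvilleSmall`, which is what the assembly `alignedTypeI_of_KMT_BS` uses below its threshold
level `k₀`. [folklore] -/
theorem twisted_norm_le_of_level_le (K : ℕ) :
    ∀ ε : ℝ, 0 < ε → ∃ n₀ : ℕ, ∀ n ≥ n₀, ∀ k ≤ K, ∀ χ : DirichletCharacter ℂ (2 ^ k),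
      ‖∑ m : Fin (2 ^ (n + k)), ((liouville ((m : ℕ) + 1) : ℤ) : ℂ) *
          χ (((m : ℕ) + 1 : ℕ) : ZMod (2 ^ k))‖ ≤ ε * 2 ^ (n + k) := by
  intro ε hε
  obtain ⟨c', hc', hmain⟩ := twisted_norm_le_of_le_sqrt
  obtain ⟨n₁, hn₁⟩ := hmain ε hε
  -- `K ≤ c' √n` as soon as `n ≥ (K / c')²`
  obtain ⟨N, hN⟩ := exists_nat_ge ((K / c') ^ 2)
  refine ⟨max n₁ N, fun n hn k hk χ => hn₁ n (le_trans (le_max_left _ _) hn) k ?_ χ⟩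
  have hnN : (K / c') ^ 2 ≤ (n : ℝ) := le_trans hN (by exact_mod_cast le_trans (le_max_right _ _) hn)
  have h1 : (K : ℝ) / c' ≤ Real.sqrt n := by
    rw [← Real.sqrt_sq (by positivity : (0 : ℝ) ≤ K / c')]
    exact Real.sqrt_le_sqrt hnN
  calc (k : ℝ) ≤ K := by exact_mod_cast hk
    _ = c' * (K / c') := by field_simp
    _ ≤ c' * Real.sqrt n := mul_le_mul_of_nonneg_left h1 hc'.le


end Summit.ValiantsHypothesis.ValiantsHypothesis.Theorems.LiouvilleSarnak.AlignedTypeI.CharactersModTwoN
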